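import Summits.CriticalPhenomena.SAWScalingLimit.Theses.SAWExcursionCardy
import Summits.CriticalPhenomena.SAWScalingLimit.Theorems.SubseqIdentification.Negative.Necessity
import Literature.Probability.RandomPlanarGeometry.SLELawOfDrivingProcessLocal
import Literature.Probability.RandomPlanarGeometry.DrivingFunctionMeasurable
import Literature.Probability.RandomPlanarGeometry.CaratheodoryHalfPlaneProofs
import Literature.Probability.RandomPlanarGeometry.ObservableDrivingMartingales

/-!
# Birth skeleton (`Lines/birth.lean`) for crux `DrivingIdentification` (stmt-CriticalPhenomena-5126)

Route `SAWExcursionCardy` of `CriticalPhenomena/SAWScalingLimit`, crux r4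

  `DrivingIdentification := SlitExcursionCardy → SimpleSubseqLimits → SubseqIdentification`

(the two last decls inlined verbatim in the route file): from the slit form of the Cardy–Fomin
formula for the SAW (N) and the simplicity of subsequential limits (S), every probability
subsequential weak limit `μ` of the critical `δℤ²` SAW laws of a Dobrushin domain `(D; a, b)` is the
chordal SLE_{8/3} law, `IsSLELaw (8/3) D μ`.

## The line — the route header's own two-layer plan
`DrivingIdentification ⇐ FarFieldMartingales → ObservablePassage → LoewnerOfSimpleLimits`, typed on
the tree's moment-free CDHKS pipeline (the spin-Ising instance is
`Literature/Probability/LatticeModels/InterfaceSLELocal.lean`: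
`isSLELaw_three_of_subseqLimit_spinInterface_of_drivingFunction_cylinderIdentity`), with the
SAW × random-walk-excursion NON-INTERSECTION observable in place of the fermion:

* continuum observable in `ℍ` (marked boundary points `0 < x₁ < x₂`, SAW from `0` to `∞`, an
  independent Brownian excursion from `x₁` to `x₂`; `g_t` the Loewner maps, `W_t` the driver):
  `M_t = g_t′(x₁) g_t′(x₂) ((x₂ − x₁)/(g_t(x₂) − g_t(x₁)))² · F((g_t(x₁) − W_t)/(g_t(x₂) − W_t))`,
  `F(u) = (8/5) u ₂F₁(−1/2, 2; 7/2; u)` (`cardyF`; `= P[SLE_{8/3} ∩ excursion = ∅]`, Kozdron 2009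
  Thm 8.1 at `a = 2/κ = 3/4`; ODE/normalisation PROVED in tree, item `CardyFSpec`,
  `Theorems/CardyFSpec`): `excursionObservable`, evaluated on the Loewner transform of the curve and
  STOPPED at the tree's far-field stopping time `Loewner.farStopTime W y` (`y ≤ x₁`, so that before
  the stop `|W| ≤ y/128`, no marked point is swallowed, `u ∈ (0, 1)` and `0 ≤ M ≤ sup F ≤ 1`):
  `excursionProcess`. Its martingale property is recorded in monotone-class (cylinder) form,
  `ExcursionCylinderIdentity`, exactly as the tree's `…_of_cylinderIdentity_local` theorems do.
* `stub_loewnerOfSimpleLimits : LoewnerOfSimpleLimits` (L) — (S) ⇒ KS-regularity: every probability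
  subsequential limit of the SAW laws is a.s. Loewner-DESCRIBABLE through every chordal uniformizing
  map (`IsLoewnerDescribable`; the body of the shared item `SAWLaplacianWalk.LimitsDescribable`,
  stmt-CriticalPhenomena-4481, minus its `source` clause which is PROVED here from the landed
  `SubseqIdentification.Negative.ae_endpoints_of_hyps`). Content beyond the tree's producer
  `isLoewnerDescribable_mk_of_injOn` (Lawler Prop. 4.4): its divergence hypothesis
  `im φ⁻¹(c(u)) → ∞` at `b`, i.e. NO TANGENTIAL CREEPING of the limit into `b` (finite total
  capacity kills describability) — a boundary estimate for the critical SAW at its endpoint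
  (reversibility moves it to `a`).
* `stub_observablePassage : ObservablePassage` (XL, HARDEST — the typed "why it might fail" of the
  crux) — (N) + (S) + describability ⇒ for the Loewner transform `W = drivingFunction φ` of `μ`
  every stopped excursion observable satisfies the cylinder identity
  `∫ (M_t − M_s) ψ(W_{S₀}, …, W_{S_{n−1}}) dμ = 0`. Mechanism: the EXACT bounded lattice martingale
  `n ↦ P[ω ∩ γ = ∅ | γ[0, n]] = h_S · Ñ` (restriction of the excursion law + domain Markov of
  `x_c^{|γ|}`), SlitExcursionCardy (uniformly over `ρ`-separated prefixes) and the random-walk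
  cross-ratio → conformal cross-ratio, passed to the limit along the subsequence (tree pattern
  `Loewner.integral_cylinder_eq_zero_of_tendstoInDistribution`, which needs the convergence in law
  of the discrete driving functions — to be extracted from convergence to SIMPLE, describable
  limits; hitting-time levels handled by monotonicity in `y`).
* `stub_farFieldMartingales : FarFieldMartingales` (L) — pure stochastic calculus, the analogue of
  the tree's `Loewner.isLocalMartingale_hasQuadraticVariation_of_spinCylinderIdentity` for this
  observable: on ANY probability space, a continuous process `W`, `W₀ = 0`, whose stopped excursion
  observables satisfy the cylinder identities at all levels has `W/√(8/3)` a continuous local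
  martingale with `⟨W/√(8/3)⟩_t = t` (far-field expansion at `x₁ = p y`, `x₂ = q y`, `y → ∞`:
  order `y⁻¹` gives `W_t`, order `y⁻²` gives `W_t² − κ̂ t` with
  `κ̂(u) = −2[u(1+u)F′ − (1−u)F] / (u²[(1−u)F″/2 − F′]) ≡ 8/3` by the ODE of `CardyFSpec`
  `2u²(1−u)F″ + u(3−u)F′ − 3(1−u)F = 0`; localisation by `Loewner.farStopTime`, no moments).
* `DrivingIdentification_of` (kernel-checked, no `sorry`): chordal uniformizer from the tree
  (`MarkedDomain.exists_isChordalUniformizing_holds`), a.e. start at `a` (landed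
  `ae_endpoints_of_hyps`), describability (stub A), cylinder identity for `drivingFunction φ`
  (stub B) transferred to the recentred version `W − W₀` (a.e. equal; the observables only see the
  path: `excursionProcess_congr`), local martingale + bracket (stub C), and the tree's PROVED
  `isSLELaw_of_isLocalMartingale_driving_of_lt_four` (`κ = 8/3 < 4`: Lévy, Rohde–Schramm trace and
  transience are theorems of the tree) — concluding the crux BY NAME.

## Disproof / negatives used
* `Cruxes/DrivingIdentification/Disproof.lean`: none exists (`ledger crux ls stmt-CriticalPhenomena-5126`:
  no workfiles at registration, 2026-08-17) — no `_false_without_` obstruction to honour.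
* `ledger negatives --problem CriticalPhenomena` (11 entries, 2026-08-17): none concerns driving
  processes / identification; the SAW entries (stmt-0772 all-`δ` tightness, stmt-5420 hex defect
  observable, stmt-8261, stmt-8312) are not touched — no tightness and no lattice observable VALUE is
  asserted by any stub (the only lattice input is the route's own crux `SlitExcursionCardy`, taken as
  a hypothesis of stub B exactly as the crux takes it).
* BC3 certificate (planner, 2026-08-17; probe files `bc/<Stub>_probe.lean` = this file's §§1–2 +
  `example : <Stub> → DrivingIdentification` and `example : <Stub> → _root_.SAWScalingLimit`, each
  `by first | exact? | simpa [<Stub>] | (unfold <Stub>; simpa) | aesop`, `maxHeartbeats 400000`):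
  all SIX probes FAIL — `lean check` rc 1, "unsolved goals `a : <Stub> ⊢ DrivingIdentification`" /
  "`⊢ SAWScalingLimit`", "aesop: failed to prove the goal after exhaustive search" — for
  `LoewnerOfSimpleLimits` (31.6 s), `ObservablePassage` (36.4 s), `FarFieldMartingales` (38.1 s):
  no stub is cheaply the crux or the summit. `lean check --json birth.lean`: rc 0, errors [],
  sorries 3 = the three `stub_*` (file audit: `DrivingIdentification_of` conditional exactly on the
  three `Registered.stub_*`; support lemmas closed).
* Vacuity pass: `ExcursionCylinderIdentity` is not vacuous — for continuous `W` with `W₀ = 0` the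
  stopped observable is bounded (`0 ≤ M ≤ 1` before `farStopTime`, frozen after), so the Bochner
  integrals are genuine once measurability is shown (stub C's burden, as in the tree's spin/FK
  versions); `FarFieldMartingales` quantifies over all probability spaces (no hidden dependence on
  `μ`); `LoewnerOfSimpleLimits` concludes describability through EVERY uniformizer (the composition
  picks one).
-/

noncomputable section

open MeasureTheory Filter Topology Set
open scoped NNReal BoundedContinuousFunction
open UpperHalfPlane (upperHalfPlaneSet)
open Literature.Probability.RandomPlanarGeometry Literature.Probability.LatticeModels
open Summit.CriticalPhenomena.SAWScalingLimit.Theses.SAWExcursionCardy (SlitExcursionCardy SimpleSubseqLimits)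

namespace Summit.CriticalPhenomena.SAWScalingLimit.Cruxes.DrivingIdentification.Birth

/-! ### 1. Vocabulary: the continuum excursion observable and its stopped process -/

/-- The Cardy–Fomin target function of the route, `F(u) = (8/5) u ₂F₁(−1/2, 2; 7/2; u)`
(verbatim the `let F` of `ExcursionCardyFormula` / `SlitExcursionCardy` / `CardyFSpec`):
`F(0) = 0`, `F(1) = 1`, increasing, `2u²(1−u)F″ + u(3−u)F′ − 3(1−u)F = 0` (item `CardyFSpec`,
PROVED). Kozdron (2009), Thm 8.1: `P[SLE_κ(0 → ∞) ∩ (Brownian excursion x → y) = ∅] = F(x/y)` at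
`κ = 8/3`. -/
def cardyF (u : ℝ) : ℝ :=
  (8 / 5 : ℝ) * u * ₂F₁ (-1 / 2 : ℝ) (2 : ℝ) (7 / 2 : ℝ) u

/-- The REAL Loewner flow `g_t(x)` of a boundary point `x : ℝ` under the chordal Loewner chain of
`W` (`Loewner.map` is defined on all of `ℂ`, real points flow on `ℝ` until swallowed; junk `x`
afterwards — never reached before `Loewner.farStopTime W y` when `y ≤ x`). -/
def bdryFlow (W : ℝ≥0 → ℝ) (t : ℝ≥0) (x : ℝ) : ℝ :=
  (Loewner.map W t (x : ℂ)).re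

/-- The boundary derivative `g_t′(x) = exp(−∫₀ᵗ 2 ds/(g_s(x) − W_s)²) ∈ (0, 1]` of the Loewner map
at a (not yet swallowed) real point, in its integrated form (Lawler 2005, §4.1; the real-line case of
the tree's `Loewner.hasDerivAt_map`). -/
def bdryDeriv (W : ℝ≥0 → ℝ) (t : ℝ≥0) (x : ℝ) : ℝ :=
  Real.exp (∫ s in (0 : ℝ)..(t : ℝ), -2 / (bdryFlow W s.toNNReal x - W s.toNNReal) ^ 2)

/-- **The continuum excursion observable** in `ℍ` with marked boundary points `x₁ < x₂` (both
`> W`): `M_t = h_t · F(u_t)` with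
`h_t = g_t′(x₁) g_t′(x₂) ((x₂ − x₁)/(g_t(x₂) − g_t(x₁)))²`
(`= H_{ℍ∖K_t}(x₁, x₂)/H_ℍ(x₁, x₂) = exp(−2∫₀ᵗ (1/(g_s(x₁)−W_s) − 1/(g_s(x₂)−W_s))² ds) ∈ (0, 1]`,
the probability that the excursion avoids the hull — restriction property of the excursion law) and
`u_t = (g_t(x₁) − W_t)/(g_t(x₂) − W_t) ∈ (0, 1)` (the cross-ratio of `(W_t, g_t(x₁), g_t(x₂), ∞)`).
For the SLE_{8/3} driver this is the martingale `P[excursion ∩ γ = ∅ | γ[0, t]]` (domain Markov +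
Kozdron 2009 Thm 8.1); `M_0 = F(x₁/x₂)`. -/
def excursionObservable (W : ℝ≥0 → ℝ) (x₁ x₂ : ℝ) (t : ℝ≥0) : ℝ :=
  bdryDeriv W t x₁ * bdryDeriv W t x₂ * ((x₂ - x₁) / (bdryFlow W t x₂ - bdryFlow W t x₁)) ^ 2 *
    cardyF ((bdryFlow W t x₁ - W t) / (bdryFlow W t x₂ - W t))

/-- **The stopped excursion observable process** at level `y` with marked points `x₁, x₂`
(intended regime `0 < y ≤ x₁ < x₂`): the observable of the path `W · ω`, stopped at the tree's
far-field stopping time `τ_y = Loewner.farStopTime W y` (first time `128 (√t + |W_t|) ≥ y`; before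
it `|W| ≤ y/128 ≤ x₁/128`, so `x₁, x₂` are not swallowed, `u ∈ (0, 1)` and `0 ≤ M ≤ 1`). Same shape
as the tree's `Loewner.stoppedObservable` (FK case). -/
def excursionProcess {Ω : Type*} (W : ℝ≥0 → Ω → ℝ) (y x₁ x₂ : ℝ) : ℝ≥0 → Ω → ℝ :=
  MeasureTheory.stoppedProcess (fun r ω ↦ excursionObservable (fun u ↦ W u ω) x₁ x₂ r)
    (Loewner.farStopTime W y)

/-- **The excursion cylinder identities** of a real process `W` on a measure space `(Ω, P)`: for
every level `y > 0`, marked points `y ≤ x₁ < x₂`, times `s ≤ t`, finitely many earlier times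
`S_k ≤ s` and continuous `|ψ| ≤ 1`,
`∫ (M^{y;x₁,x₂}_t − M^{y;x₁,x₂}_s) · ψ(W_{S₀}, …, W_{S_{n−1}}) dP = 0` — the monotone-class form of
"every stopped excursion observable is a martingale in the filtration generated by `W`" (cf. the
hypothesis of the tree's `Loewner.isLocalMartingale_hasQuadraticVariation_of_spinCylinderIdentity`). -/
def ExcursionCylinderIdentity {Ω : Type*} [MeasurableSpace Ω] (P : Measure Ω) (W : ℝ≥0 → Ω → ℝ) :
    Prop :=
  ∀ y : ℝ, 0 < y → ∀ x₁ x₂ : ℝ, y ≤ x₁ → x₁ < x₂ → ∀ s t : ℝ≥0, s ≤ t →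
    ∀ (n : ℕ) (S : Fin n → ℝ≥0), (∀ k, S k ≤ s) → ∀ ψ : (Fin n → ℝ) → ℝ, Continuous ψ →
      (∀ v, |ψ v| ≤ 1) →
        ∫ ω, (excursionProcess W y x₁ x₂ t ω - excursionProcess W y x₁ x₂ s ω) *
          ψ (fun k ↦ W (S k) ω) ∂P = 0

/-! ### 2. The three stub statements -/

/-- STUB A statement — **Loewner parametrisation of the simple subsequential limits** ((S) ⇒
Kemppainen–Smirnov regularity): if every probability subsequential weak limit of the critical SAW
laws is carried by simple curves meeting `∂D` only at `a, b` (`SimpleSubseqLimits`, the route's r5,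
by name), then every such limit `μ` is, for EVERY chordal uniformizing map `φ : ℍ → D` of
`(D; a, b)`, a.s. carried by curve classes DESCRIBABLE by the Loewner evolution through `φ`
(`IsLoewnerDescribable`: capacity-parametrised pull-back generated by a curve with a continuous
driving function on `[0, ∞)`). This is the body of the shared item `SAWLaplacianWalk.LimitsDescribable`
(stmt-CriticalPhenomena-4481) without its `source` clause, under the extra hypothesis (S). -/
def LoewnerOfSimpleLimits : Prop :=
  SimpleSubseqLimits →
    ∀ (D : DobrushinDomain) (a b : ℝ → Site 2), SAW.IsEndpointApprox D a b →
      ∀ (φ : ConformalEquiv upperHalfPlaneSet D.carrier), D.IsChordalUniformizing φ →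
        ∀ (s : ℕ → ℝ) (μ : Measure (CurveClass ℂ)), Tendsto s atTop (𝓝[>] (0 : ℝ)) →
          IsProbabilityMeasure μ →
          (∀ f : CurveClass ℂ →ᵇ ℝ, Tendsto (fun n ↦ ∫ γ, f γ.curve
            ∂(SAW.law D.carrier (s n) (a (s n)) (b (s n)))) atTop (𝓝 (∫ x, f x ∂μ))) →
          ∀ᵐ c ∂μ, IsLoewnerDescribable φ c

/-- STUB B statement — **observable passage**: from `SlitExcursionCardy` (N), `SimpleSubseqLimits`
(S) and describability, for every Dobrushin domain, endpoint approximation, chordal uniformizing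
map `φ`, and probability subsequential weak limit `μ` of the SAW laws that is a.s. describable
through `φ` and a.s. starts at `a`, the Loewner transform `W = drivingFunction φ` (a Borel function
of the curve) satisfies the excursion cylinder identities under `μ`: every stopped excursion
observable `M^{y;x₁,x₂}` (`0 < y ≤ x₁ < x₂`, marked points on the arc `φ((0, ∞))`) is a martingale
in the filtration of `W`. -/
def ObservablePassage : Prop :=
  SlitExcursionCardy → SimpleSubseqLimits →
    ∀ (D : DobrushinDomain) (a b : ℝ → Site 2), SAW.IsEndpointApprox D a b →
      ∀ (φ : ConformalEquiv upperHalfPlaneSet D.carrier), D.IsChordalUniformizing φ →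
        ∀ (s : ℕ → ℝ) (μ : Measure (CurveClass ℂ)), Tendsto s atTop (𝓝[>] (0 : ℝ)) →
          IsProbabilityMeasure μ →
          (∀ f : CurveClass ℂ →ᵇ ℝ, Tendsto (fun n ↦ ∫ γ, f γ.curve
            ∂(SAW.law D.carrier (s n) (a (s n)) (b (s n)))) atTop (𝓝 (∫ x, f x ∂μ))) →
          (∀ᵐ c ∂μ, IsLoewnerDescribable φ c) → (∀ᵐ c ∂μ, c.source = D.pt 0) →
          ExcursionCylinderIdentity μ (fun t c ↦ drivingFunction φ c t)

/-- STUB C statement — **far-field extraction of the driving martingales**: on any probability space,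
a real process `W` with strongly measurable coordinates, continuous paths and `W₀ = 0` whose stopped
excursion observables satisfy the cylinder identities at all levels has `W/√(8/3)` a continuous local
martingale with quadratic variation `t` in its natural filtration (Lévy's format, the input of the
tree's `isSLELaw_of_isLocalMartingale_driving_of_lt_four`). Expansion of `M^{y; py, qy}` at `y → ∞`
on `[0, τ_L]`: order `y⁻¹` is `F′(u₀)u₀(1/q − 1/p) · W_t` (`F′ > 0`), order `y⁻²` is
`(1−u₀)[(−F′ + ½(1−u₀)F″) W_t² + (2/u₀²)(−(1−u₀)F + u₀(1+u₀)F′) t]` (`q = 1`, `u₀ = p`), and the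
`CardyFSpec` ODE makes the ratio `κ̂ ≡ 8/3`. -/
def FarFieldMartingales : Prop :=
  ∀ {Ω : Type} [MeasurableSpace Ω] (P : Measure Ω) [IsProbabilityMeasure P] (W : ℝ≥0 → Ω → ℝ)
    (hW : ∀ t, StronglyMeasurable (W t)), (∀ ω, Continuous (W · ω)) → (∀ ω, W 0 ω = 0) →
    ExcursionCylinderIdentity P W →
      Literature.Probability.RandomPlanarGeometry.IsLocalMartingale
          (fun t ω ↦ (Real.sqrt (8 / 3))⁻¹ * W t ω) (Filtration.natural W hW) P ∧
        Literature.Probability.Process.HasQuadraticVariation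
          (fun t ω ↦ (Real.sqrt (8 / 3))⁻¹ * W t ω) (fun t _ ↦ (t : ℝ)) (Filtration.natural W hW) P

/-! ### 3. Path dependence of the stopped observable (sorry-free bookkeeping for the composition) -/

/-- The far-field stopping time reads the path only (definitional). -/
theorem farStopTime_eq_path {Ω : Type*} (W : ℝ≥0 → Ω → ℝ) (y : ℝ) (ω : Ω) :
    Loewner.farStopTime W y ω = Loewner.farStopTime (fun u (_ : Unit) ↦ W u ω) y () := rfl

/-- Two processes with the same path at `ω` have the same far-field stopping time at `ω`. -/
theorem farStopTime_congr {Ω : Type*} {W₁ W₂ : ℝ≥0 → Ω → ℝ} {ω : Ω} (h : ∀ u, W₁ u ω = W₂ u ω)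
    (y : ℝ) : Loewner.farStopTime W₁ y ω = Loewner.farStopTime W₂ y ω := by
  have hp : (fun u (_ : Unit) ↦ W₁ u ω) = fun u (_ : Unit) ↦ W₂ u ω := by
    funext u _
    exact h u
  rw [farStopTime_eq_path W₁, farStopTime_eq_path W₂, hp]

/-- Two processes with the same path at `ω` have the same stopped excursion observables at `ω`. -/
theorem excursionProcess_congr {Ω : Type*} {W₁ W₂ : ℝ≥0 → Ω → ℝ} {ω : Ω}
    (h : ∀ u, W₁ u ω = W₂ u ω) (y x₁ x₂ : ℝ) (t : ℝ≥0) :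
    excursionProcess W₁ y x₁ x₂ t ω = excursionProcess W₂ y x₁ x₂ t ω := by
  have hp : (fun u ↦ W₁ u ω) = fun u ↦ W₂ u ω := funext h
  simp only [excursionProcess, MeasureTheory.stoppedProcess, farStopTime_congr h y, hp]

/-! ### 4. The registered stubs (the only `sorry`s of the file) -/

/-- STUB A (L): (S) ⇒ a.s. Loewner-describability of every probability subsequential limit through
every chordal uniformizing map. Why plausibly true: simple chords from `a` to `b` meeting `∂D` only
at the endpoints are describable as soon as the pull-back enters `∞` with `im → ∞`
(`isLoewnerDescribable_mk_of_injOn`), and tangential creeping of the critical SAW into its endpoint is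
a boundary large deviation; why it might fail: only sub-ballistic / bridge estimates are in print. -/
theorem stub_loewnerOfSimpleLimits : LoewnerOfSimpleLimits := by
  sorry

/-- STUB B (XL, HARDEST): (N) + (S) + describability ⇒ the excursion cylinder identities for the
Loewner transform of every probability subsequential limit. Why it might fail: convergence in law of
the discrete driving functions must be extracted from convergence to simple describable limits alone,
and the random-walk cross-ratio → conformal cross-ratio is needed uniformly over slit domains. -/
theorem stub_observablePassage : ObservablePassage := by
  sorry

/-- STUB C (L): cylinder identities at all levels ⇒ `W/√(8/3)` is a continuous local martingale with
bracket `t` (far-field expansion of the excursion observable + the `CardyFSpec` ODE; localisation by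
`Loewner.farStopTime`, no moment hypothesis). Why it might fail: only through a mis-normalised
observable — the expansion coefficients are explicit and `κ̂ ≡ 8/3` is an identity of the ODE. -/
theorem stub_farFieldMartingales : FarFieldMartingales := by
  sorry

/-! ### Name-keyed aliases of the stub statements (hypotheses of the composition)

`Registered.stub_X : Prop` is the statement of `stub_X` under the registered stub's short name, so
that the skeleton audit (`#h21_check_skeleton`: hypotheses admissible iff registered stubs BY NAME)
accepts `DrivingIdentification_of : Registered.stub_… → … → DrivingIdentification` (device of
`Cruxes/ChainLaw/Lines/birth.lean`). -/
namespace Registered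

/-- Alias keyed by the registered stub name. -/
abbrev stub_loewnerOfSimpleLimits : Prop := LoewnerOfSimpleLimits
/-- Alias keyed by the registered stub name. -/
abbrev stub_observablePassage : Prop := ObservablePassage
/-- Alias keyed by the registered stub name. -/
abbrev stub_farFieldMartingales : Prop := FarFieldMartingales

end Registered

/-! ### 5. The composition (kernel-checked, no `sorry`) -/

/-- **The three stubs imply the crux `DrivingIdentification` BY NAME.** Given (N) and (S) and a
probability subsequential limit `μ` of the SAW laws of `(D; a, b)`: take a chordal uniformizing map
`φ` (tree, Riemann + Carathéodory), the a.s. start at `a` (landed `ae_endpoints_of_hyps`),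
describability (stub A) and the cylinder identities for `W = drivingFunction φ` (stub B); transfer
them to the recentred version `W′ = W − W₀` (`= W` a.s.; the observables and test functions only see
the path), extract the driving local martingales (stub C), and conclude with the tree's PROVED
`isSLELaw_of_isLocalMartingale_driving_of_lt_four` at `κ = 8/3 < 4`. -/
theorem DrivingIdentification_of (hA : Registered.stub_loewnerOfSimpleLimits)
    (hB : Registered.stub_observablePassage) (hC : Registered.stub_farFieldMartingales) :
    Summit.CriticalPhenomena.SAWScalingLimit.Theses.SAWExcursionCardy.DrivingIdentification := by
  intro hN hS D a b hab s μ hs hμ hlim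
  haveI := hμ
  -- (0) a chordal uniformizing map of `(D; a, b)` (Riemann mapping + Carathéodory, tree)
  obtain ⟨φ, hφ⟩ := MarkedDomain.exists_isChordalUniformizing_holds D
  -- (i) Loewner parametrisation of the (simple) limit [stub A]; a.s. start at `a` [landed]
  have hdesc : ∀ᵐ c ∂μ, IsLoewnerDescribable φ c := hA hS D a b hab φ hφ s μ hs hμ hlim
  have hsrc : ∀ᵐ c ∂μ, c.source = D.pt 0 :=
    (Summit.CriticalPhenomena.SAWScalingLimit.Theorems.SubseqIdentification.Negative.ae_endpoints_of_hyps
      hab hs hlim).mono fun c hc => hc.1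
  -- (ii) the stopped excursion observables of the Loewner transform are martingales [stub B]
  have hcyl : ExcursionCylinderIdentity μ (fun t c ↦ drivingFunction φ c t) :=
    hB hN hS D a b hab φ hφ s μ hs hμ hlim hdesc hsrc
  -- the recentred version `W′ = W − W₀` of the Loewner transform
  set W : CurveClass ℂ → ℝ≥0 → ℝ := drivingFunction φ with hWdef
  set W' : CurveClass ℂ → ℝ≥0 → ℝ := fun c t ↦ W c t - W c 0 with hW'
  have hae0 : ∀ᵐ c ∂μ, W c 0 = 0 := ae_drivingFunction_apply_zero hφ hsrc
  have haeW : ∀ᵐ c ∂μ, W' c = W c := by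
    filter_upwards [hae0] with c hc
    funext t
    simp [hW', hc]
  have hW'm : ∀ t, StronglyMeasurable (fun c ↦ W' c t) := fun t ↦
    (stronglyMeasurable_drivingFunction_apply hφ t).sub
      (stronglyMeasurable_drivingFunction_apply hφ 0)
  have hW'c : ∀ c, Continuous (W' c) := fun c ↦
    (continuous_drivingFunction φ c).sub continuous_const
  have hW'0 : ∀ c, W' c 0 = 0 := fun c ↦ by simp [hW']
  -- the cylinder identities transfer to `W′` (a.e. equal paths)
  have hcyl' : ExcursionCylinderIdentity μ (fun t c ↦ W' c t) := by
    intro y hy x₁ x₂ hx₁ hx₂ s₁ t₁ hst n S hSk ψ hψc hψb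
    rw [← hcyl y hy x₁ x₂ hx₁ hx₂ s₁ t₁ hst n S hSk ψ hψc hψb]
    refine integral_congr_ae ?_
    filter_upwards [haeW] with c hcW
    have hpath : ∀ u, (fun t c ↦ W' c t) u c = (fun t c ↦ W c t) u c := fun u ↦ congrFun hcW u
    simp only [excursionProcess_congr (W₁ := fun t c ↦ W' c t) (W₂ := fun t c ↦ W c t) (ω := c)
      hpath, hcW]
  -- (iii) far field [stub C]: `W′/√(8/3)` is a continuous local martingale with `⟨·⟩_t = t`
  obtain ⟨hloc, hQ⟩ := hC μ (fun t c ↦ W' c t) hW'm hW'c hW'0 hcyl'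
  -- (iv) Lévy + Rohde–Schramm at `κ = 8/3 < 4` (theorems of the tree)
  have hsq : Real.sqrt ((((8 : ℝ≥0) / 3 : ℝ≥0)) : ℝ) = Real.sqrt (8 / 3) := by
    rw [NNReal.coe_div]
    norm_num
  have hκ0 : (0 : ℝ≥0) < (8 : ℝ≥0) / 3 := by positivity
  have hκ4 : (8 : ℝ≥0) / 3 < 4 := by
    rw [div_lt_iff₀ (by norm_num : (0 : ℝ≥0) < 3)]
    norm_num
  refine isSLELaw_of_isLocalMartingale_driving_of_lt_four hκ0 hκ4 hφ (W := W')
    (fun t ↦ (hW'm t).measurable) (ae_of_all _ hW'0) (ae_of_all _ hW'c)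
    (𝓕 := Filtration.natural (fun t c ↦ W' c t) hW'm) ?_ ?_ ?_
  · simpa only [hsq] using hloc
  · simpa only [hsq] using hQ
  · filter_upwards [hdesc, haeW] with c hc hcW
    rw [hcW]
    obtain ⟨-, γ, hγ, c', hc', hI⟩ := isLoewnerDescribed_drivingFunction hc
    exact ⟨γ, hγ, c', hc', hI⟩

/-- Wiring check: the registered stubs feed `DrivingIdentification_of` as stated. -/
example : Summit.CriticalPhenomena.SAWScalingLimit.Theses.SAWExcursionCardy.DrivingIdentification :=
  DrivingIdentification_of stub_loewnerOfSimpleLimits stub_observablePassage stub_farFieldMartingales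

end Summit.CriticalPhenomena.SAWScalingLimit.Cruxes.DrivingIdentification.Birth

end
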